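/-
Copyright (c) 2026. All rights reserved.
Released under Apache 2.0 license as described in the file LICENSE.
Authors: abc-iut cell, wave-4 seat abc-iut-w4-d059 (proof-only; row T54-0b with the input `huniqN`
DISCHARGED from edge data: a verticial subgroup lies in no edge-like subgroup + Kőnig on locally finite trees).
-/
import Literature.AnabelianGeometry.SemiGraphs.ArithVertGpStabilizer
import Literature.AnabelianGeometry.SemiGraphs.TreeSystemFixedSystemUnique
import Literature.AnabelianGeometry.SemiGraphs.TemperedVerticialNotEdgeLike
import Literature.AnabelianGeometry.SemiGraphs.TemperedEdgeInVerticialProofs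
import HarnessLib

/-!
# [SemiAnbd] §5 p. 65 / Thm 5.4 (i): `Π^temp_{𝔊,v}` is the stabiliser of the vertex system of `v`,
# with the uniqueness input discharged from the edge dictionary (proof-only)

Mochizuki, *Semi-graphs of anabelioids*, Publ. RIMS **42** (2006), §5 p. 65 ("`Π^temp_{𝔊,v}` … the
commensurator in `Π^temp_𝔊` of `Π^temp_{𝔾,v}`") and the proofs of Thm 3.7 (iii) p. 41 / Thm 5.4 (i) p. 66
with the author's Comments (6)(b). [cite: MochizukiSemiAnbd2006, Thm 5.4 (i), p. 66]

PROOF-ONLY sequel to `ArithVertGpStabilizer.lean` (abc-iut cell, sub-DAG SemiAnbd-Thm54 row **T54-0b**,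
seat abc-iut-w4-d059).  There, the description of the arithmetic decomposition group `arithVertGp R ι v`
as the stabiliser of the compatible tree-vertex system of `v` (and the two-sided fields (AI1) `fix` /
(AI2) `stab` of abc-iut-w4-d053's `ArithLevelData` for the produced data `decompositionDataOfChart R ι`)
took as input `huniqN`: "a §3 verticial subgroup fixes at most one compatible vertex system".  Here
`huniqN` is DISCHARGED (`huniqN_of_edgeData`) from level-data-shaped inputs only: trees, functorial and
equivariant transitions (`f_id`, `f_comp`, `trans_act` — fields of `ArithLevelData`), LOCAL FINITENESS of
the trees (finite stars: they are universal coverings of finite graphs), and the one-sided edge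
dictionary (I3) for the restricted action of `Π^temp_𝔾` (the field `edge` of abc-iut-L3-t10's
`VerticialLevelData`, without its `proj` clause): the stabiliser of an eventual compatible edge system
lies in an edge-like subgroup.  The geometric fact used is "a verticial subgroup of `π₁^temp(𝒢)` is
contained in no edge-like subgroup" (`mem_verticialSubgroups_not_le_mem_edgeLikeSubgroups`, from
Thm 3.7 (i)(ii) discharged + Def 2.4 (i) elevatedness, via abc-iut-w4-d040/L3-t11's files), and the
tree-level Kőnig argument `SemiGraph.eq_of_forall_fixed_of_no_fixed_closedEdges`.  Consequences:
`mem_arithVertGp_iff_fixes_of_edgeData`, `isVerticial_decompositionDataOfChart_iff_exists_stabilizer_of_edgeData`.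
Nothing here takes a side on [IUTchIII] Cor. 3.12; typed ≠ proved elsewhere.
-/

namespace Literature.AnabelianGeometry.SemiGraphs

namespace ProfiniteSemiGraph

open CategoryTheory

universe v u u' w

variable {𝒢 : ProfiniteSemiGraph.{u}} {c : TemperedPiChart 𝒢} {Gtp : Type u'} [Group Gtp]
  (ι : c.G →* Gtp) {J : Type v} [Preorder J] (T : J → SemiGraph.{w}) (ρ : ∀ j, Gtp →* Aut (T j))
  (f : ∀ ⦃i j : J⦄, i ≤ j → (T j ⟶ T i))

/-! ### A verticial subgroup lies in no edge-like subgroup -/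

omit [Group Gtp] [Preorder J] in
/-- **A verticial subgroup of `π₁^temp(𝒢)` is contained in no edge-like subgroup** (Thm 3.7 (iii)/(iv)
p. 41: the edge-like `L ≥ H` lies in a verticial host `H'` at an abutting vertex (abc-iut-L3-t11's
`exists_mem_verticialSubgroups_ge`), nested verticial subgroups coincide (Thm 3.7 (ii)), so `H = L` would
be edge-like, against `not_mem_edgeLikeSubgroups_of_mem_verticialSubgroups`); unconditional under the
hypotheses of Thm 3.7 (no `IsGraph` hypothesis; abc-iut-w4-d053's `TemperedVerticialFixUnique.lean` has the
twin `not_le_of_mem_verticialSubgroups_of_mem_edgeLikeSubgroups` for graphs). [cite: MochizukiSemiAnbd2006, Thm 3.7 (iii), p. 41] -/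
theorem mem_verticialSubgroups_not_le_mem_edgeLikeSubgroups (h𝒢 : 𝒢.Thm37Hypotheses)
    (c : TemperedPiChart 𝒢) {v : 𝒢.graph.Vertex} {e : 𝒢.graph.Edge} {H L : Subgroup c.G}
    (hH : H ∈ verticialSubgroups c v) (hL : L ∈ edgeLikeSubgroups c e) : ¬ H ≤ L := by
  intro hle
  -- an abutting branch `b` of `e` at a vertex `w`, and a verticial subgroup at `w`
  obtain ⟨w₀⟩ := h𝒢.hasVertex
  obtain ⟨b, hbe, hs⟩ := SemiGraph.exists_abuts_of_isConnected h𝒢.isConnected w₀ e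
  obtain ⟨w, hw⟩ := Option.isSome_iff_exists.mp hs
  subst hbe
  have hne : (verticialSubgroups c w).Nonempty := by
    obtain ⟨K, φ, hφ, -⟩ := (verticialInjective_holds 𝒢 h𝒢 c w).1
    exact ⟨_, range_mem_verticialSubgroups c φ hφ⟩
  -- the verticial host `H' ≥ L ≥ H` equals `H`
  obtain ⟨H', hH', hLH'⟩ := exists_mem_verticialSubgroups_ge c hw hL hne
  have hHH' : H = H' :=
    eq_of_le_of_mem_verticialSubgroups verticialDistinct_holds h𝒢 c hH hH' (hle.trans hLH')
  subst hHH'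
  have hLH : L = H := le_antisymm hLH' hle
  subst hLH
  exact not_mem_edgeLikeSubgroups_of_mem_verticialSubgroups h𝒢 c hH hL

/-! ### The uniqueness input `huniqN`, discharged -/

/-- **`huniqN` discharged**: a §3 verticial subgroup fixes AT MOST ONE compatible system of vertices of
the arithmetic trees (restricted action `n ↦ ρ j (ι n)`), given trees with functorial equivariant
transitions, finite stars, and the one-sided edge dictionary (I3) for the restricted action.  (Comments
(6)(b): two fixed systems give a compatible fixed system of closed edges by Kőnig, whose stabiliser lies
in an edge-like subgroup containing the verticial one — impossible.)
[cite: MochizukiSemiAnbd2006, Thm 3.7(iii) p.41] -/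
theorem huniqN_of_edgeData [IsDirectedOrder J] (h𝒢 : 𝒢.Thm37Hypotheses) (hT : ∀ j, (T j).IsTree)
    (f_id : ∀ j, f (le_refl j) = 𝟙 (T j))
    (f_comp : ∀ ⦃i j k : J⦄ (hij : i ≤ j) (hjk : j ≤ k), f hjk ≫ f hij = f (hij.trans hjk))
    (trans_act : ∀ ⦃i j : J⦄ (h : i ≤ j) (g : Gtp), (ρ j g).hom ≫ f h = f h ≫ (ρ i g).hom)
    (hlocfin : ∀ (j : J) (y : (T j).Vertex), Set.Finite {b : (T j).Branch | (T j).abuts b = some y})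
    (hedgeN : ∀ (j₁ : J) (ε : ∀ j : {j : J // j₁ ≤ j}, (T j.1).Edge),
      (∀ ⦃i j : {j : J // j₁ ≤ j}⦄ (h : i.1 ≤ j.1), (f h).edgeMap (ε j) = ε i) →
      ∃ (e : 𝒢.graph.Edge) (L : Subgroup c.G), L ∈ edgeLikeSubgroups c e ∧
        ∀ n : c.G, (∀ j, (ρ j.1 (ι n)).hom.edgeMap (ε j) = ε j ∧
          ∀ b : (T j.1).Branch, (T j.1).edgeOf b = ε j → (ρ j.1 (ι n)).hom.branchMap b = b) → n ∈ L) :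
    ∀ (v : 𝒢.graph.Vertex) (H : Subgroup c.G), H ∈ verticialSubgroups c v →
      ∀ x x' : ∀ j, (T j).Vertex,
      (∀ ⦃i j : J⦄ (h : i ≤ j), (f h).vertexMap (x j) = x i) →
      (∀ ⦃i j : J⦄ (h : i ≤ j), (f h).vertexMap (x' j) = x' i) →
      (∀ n ∈ H, ∀ j, (ρ j (ι n)).hom.vertexMap (x j) = x j) →
      (∀ n ∈ H, ∀ j, (ρ j (ι n)).hom.vertexMap (x' j) = x' j) → x = x' := by
  intro v H hH x x' hx hx' hfx hfx'
  refine SemiGraph.eq_of_forall_fixed_of_no_fixed_closedEdges T hT (fun j => (ρ j).comp ι) f f_id f_comp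
    ?_ hlocfin H ?_ hx hx' hfx hfx'
  · intro i j h n e
    have := congrArg (fun φ : T j ⟶ T i => φ.edgeMap e) (trans_act h (ι n))
    simpa using this
  · intro j₁ ε hε _ hfix
    obtain ⟨e, L, hL, hLfix⟩ := hedgeN j₁ ε hε
    exact mem_verticialSubgroups_not_le_mem_edgeLikeSubgroups h𝒢 c hH hL
      fun n hn => hLfix n (hfix n hn)

/-- Pointwise equivariance on vertices, from the morphism-level `trans_act`.
[cite: MochizukiSemiAnbd2006, Thm 5.4 (i), p. 66] -/
theorem trans_act_vertexMap'
    (trans_act : ∀ ⦃i j : J⦄ (h : i ≤ j) (g : Gtp), (ρ j g).hom ≫ f h = f h ≫ (ρ i g).hom)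
    ⦃i j : J⦄ (h : i ≤ j) (g : Gtp) (y : (T j).Vertex) :
    (f h).vertexMap ((ρ j g).hom.vertexMap y) = (ρ i g).hom.vertexMap ((f h).vertexMap y) := by
  have := congrArg (fun φ : T j ⟶ T i => φ.vertexMap y) (trans_act h g)
  simpa using this

/-! ### Row T54-0b with level-data-shaped inputs only -/

/-- **Row T54-0b, all inputs level-data-shaped**: `g ∈ arithVertGp R ι v ↔ g` fixes the compatible
tree-vertex system `x` of `v` (the system of which `R.Hv v` is the full `Π^temp_𝔾`-stabiliser), from:
trees with functorial equivariant transitions and finite stars, `ι` injective with normal image, the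
geometric two-sided vertex dictionary `hstabN` and the one-sided edge dictionary `hedgeN` for the
restricted action. [cite: MochizukiSemiAnbd2006, §5, p. 65] -/
theorem mem_arithVertGp_iff_fixes_of_edgeData [IsDirectedOrder J] (h𝒢 : 𝒢.Thm37Hypotheses)
    (R : ChartRepresentatives c) (hι : Function.Injective ι) (hnorm : (ι.range).Normal)
    (hT : ∀ j, (T j).IsTree) (f_id : ∀ j, f (le_refl j) = 𝟙 (T j))
    (f_comp : ∀ ⦃i j k : J⦄ (hij : i ≤ j) (hjk : j ≤ k), f hjk ≫ f hij = f (hij.trans hjk))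
    (trans_act : ∀ ⦃i j : J⦄ (h : i ≤ j) (g : Gtp), (ρ j g).hom ≫ f h = f h ≫ (ρ i g).hom)
    (hlocfin : ∀ (j : J) (y : (T j).Vertex), Set.Finite {b : (T j).Branch | (T j).abuts b = some y})
    (hstabN : ∀ x : ∀ j, (T j).Vertex, (∀ ⦃i j : J⦄ (h : i ≤ j), (f h).vertexMap (x j) = x i) →
      ∃ (v : 𝒢.graph.Vertex) (H : Subgroup c.G), H ∈ verticialSubgroups c v ∧
        ∀ n : c.G, n ∈ H ↔ ∀ j, (ρ j (ι n)).hom.vertexMap (x j) = x j)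
    (hedgeN : ∀ (j₁ : J) (ε : ∀ j : {j : J // j₁ ≤ j}, (T j.1).Edge),
      (∀ ⦃i j : {j : J // j₁ ≤ j}⦄ (h : i.1 ≤ j.1), (f h).edgeMap (ε j) = ε i) →
      ∃ (e : 𝒢.graph.Edge) (L : Subgroup c.G), L ∈ edgeLikeSubgroups c e ∧
        ∀ n : c.G, (∀ j, (ρ j.1 (ι n)).hom.edgeMap (ε j) = ε j ∧
          ∀ b : (T j.1).Branch, (T j.1).edgeOf b = ε j → (ρ j.1 (ι n)).hom.branchMap b = b) → n ∈ L)
    {v : 𝒢.graph.Vertex} {x : ∀ j, (T j).Vertex}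
    (hx : ∀ ⦃i j : J⦄ (h : i ≤ j), (f h).vertexMap (x j) = x i)
    (hvx : ∀ n : c.G, n ∈ R.Hv v ↔ ∀ j, (ρ j (ι n)).hom.vertexMap (x j) = x j) (g : Gtp) :
    g ∈ arithVertGp R ι v ↔ ∀ j, (ρ j g).hom.vertexMap (x j) = x j :=
  mem_arithVertGp_iff_fixes ι T ρ f h𝒢 R hι hnorm (trans_act_vertexMap' T ρ f trans_act) hstabN
    (huniqN_of_edgeData ι T ρ f h𝒢 hT f_id f_comp trans_act hlocfin hedgeN) hx hvx g

/-- **Fields (AI1)+(AI2) of the arithmetic level data for the produced data, all inputs level-data-shaped**: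
the verticial subgroups of `decompositionDataOfChart R ι` are EXACTLY the full `Gtp`-stabilisers of
compatible systems of tree vertices. [cite: MochizukiSemiAnbd2006, Thm 5.4 (i), p. 66] -/
theorem isVerticial_decompositionDataOfChart_iff_exists_stabilizer_of_edgeData [IsDirectedOrder J]
    (h𝒢 : 𝒢.Thm37Hypotheses) (R : ChartRepresentatives c) (hι : Function.Injective ι)
    (hnorm : (ι.range).Normal) (hT : ∀ j, (T j).IsTree) (f_id : ∀ j, f (le_refl j) = 𝟙 (T j))
    (f_comp : ∀ ⦃i j k : J⦄ (hij : i ≤ j) (hjk : j ≤ k), f hjk ≫ f hij = f (hij.trans hjk))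
    (trans_act : ∀ ⦃i j : J⦄ (h : i ≤ j) (g : Gtp), (ρ j g).hom ≫ f h = f h ≫ (ρ i g).hom)
    (hlocfin : ∀ (j : J) (y : (T j).Vertex), Set.Finite {b : (T j).Branch | (T j).abuts b = some y})
    (hfixN : ∀ (v : 𝒢.graph.Vertex) (H : Subgroup c.G), H ∈ verticialSubgroups c v →
      ∃ x : ∀ j, (T j).Vertex, (∀ ⦃i j : J⦄ (h : i ≤ j), (f h).vertexMap (x j) = x i) ∧
        ∀ n : c.G, n ∈ H ↔ ∀ j, (ρ j (ι n)).hom.vertexMap (x j) = x j)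
    (hstabN : ∀ x : ∀ j, (T j).Vertex, (∀ ⦃i j : J⦄ (h : i ≤ j), (f h).vertexMap (x j) = x i) →
      ∃ (v : 𝒢.graph.Vertex) (H : Subgroup c.G), H ∈ verticialSubgroups c v ∧
        ∀ n : c.G, n ∈ H ↔ ∀ j, (ρ j (ι n)).hom.vertexMap (x j) = x j)
    (hedgeN : ∀ (j₁ : J) (ε : ∀ j : {j : J // j₁ ≤ j}, (T j.1).Edge),
      (∀ ⦃i j : {j : J // j₁ ≤ j}⦄ (h : i.1 ≤ j.1), (f h).edgeMap (ε j) = ε i) →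
      ∃ (e : 𝒢.graph.Edge) (L : Subgroup c.G), L ∈ edgeLikeSubgroups c e ∧
        ∀ n : c.G, (∀ j, (ρ j.1 (ι n)).hom.edgeMap (ε j) = ε j ∧
          ∀ b : (T j.1).Branch, (T j.1).edgeOf b = ε j → (ρ j.1 (ι n)).hom.branchMap b = b) → n ∈ L)
    (W : Subgroup Gtp) :
    IsVerticial (decompositionDataOfChart R ι) W ↔
      ∃ x : ∀ j, (T j).Vertex, (∀ ⦃i j : J⦄ (h : i ≤ j), (f h).vertexMap (x j) = x i) ∧
        ∀ g : Gtp, g ∈ W ↔ ∀ j, (ρ j g).hom.vertexMap (x j) = x j :=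
  isVerticial_decompositionDataOfChart_iff_exists_stabilizer ι T ρ f h𝒢 R hι hnorm
    (trans_act_vertexMap' T ρ f trans_act) hfixN hstabN
    (huniqN_of_edgeData ι T ρ f h𝒢 hT f_id f_comp trans_act hlocfin hedgeN) W

end ProfiniteSemiGraph

end Literature.AnabelianGeometry.SemiGraphs
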